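import Mathlib
import Literature.NumberTheory.LFunctions.Zhang2022.Section18DefsE
import Literature.NumberTheory.LFunctions.Zhang2022.TypedSection15C
import HarnessLib

/-!
# Zhang (2022) §15: the 𝔢-dependent nodes PARAMETRISED over the value of `e″₁ⱼ` (RT-05 E-twins,
# statement only): `Lemma151ChiE`, `Lemma151ChiRE`, `Eq15_22E`, `Eq15_23RE`

Topic `Literature/NumberTheory/LFunctions/Zhang2022` (Landau–Siegel audit tree; verdict-neutral).
Y. Zhang, *Discrete mean estimates and the Landau–Siegel zero*, arXiv:2211.02515v1 (2022)
[Zhang2022LandauSiegel] — **an unrefereed manuscript under adjudication; every `def … : Prop` below is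
a CLAIM OF THE MANUSCRIPT (or its reading of record) with ONE constant made a parameter, STATED NOT
ASSERTED; nothing here asserts or denies Theorems 1–2.** Lane ZHANG-L, WP15 typer file for RE-TYPE
RT-05 (zl-lead R-22/R-28; zl-ref-chief conditions C1–C5; RETYPE-LEDGER row RT-05; cell rows
G-L4t10-1, G-num2-1, D-G-num2-1).

WHAT AND WHY. Lemma 15.1 (§15 p. 86) evaluates `Σ_{(n,𝔮)=1} b(n₁n)χ(n)ϱ*ⱼ(n)/n = χ(n₁)τ₂(n₁)𝔢ⱼ + …` with
`𝔢ⱼ = (e₁ⱼ + ι₂e₂ⱼ)(ῑ₃e₃ⱼ + ῑ₄e₂ⱼ)`, `e₁ⱼ = e′₁ⱼ − e″₁ⱼ`; the value of `e″₁ⱼ` STATED in Lemma 15.1/(B.3)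
(`e1ppj`) is NOT the value the manuscript's own Appendix-B computation yields — the DERIVED constant is
`e″₁ⱼ = −jπi·b*` (`AppendixB.e1ppD`, `e1ppD_eq`; kernel: `Numerics.not_StepB_u015c`,
`Numerics.appB3_chain_inconsistent`, `Section18EpsilonIdentity.e1pp_delta_one_norm_bounds`). RT-05
carries every 𝔢-dependent node PARAMETRISED over `e1pp : ℕ → ℂ` through the single family
`frakeE e1pp j` (`Section18DefsE`, condition C1) and has the dischargers target the `e1ppD`-instance;
the printed nodes are byte-untouched and are the `e1ppj`-instances BY `rfl` (bridges below), so the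
as-printed record stays valid (condition C2). This file types the WP15 members of the family:
`Skeleton.Lemma151ChiE / Lemma151ChiRE` (the χ-twisted Lemma 15.1 of `SkeletonChiTwist` /
`SkeletonAlpha1`), `Typed.Section15C.Eq15_22E` ((15.22)), `Typed.Section15C.Eq15_23RE` ((15.23) in the
repaired `O(1/𝓛)` reading G-L4t3-3). (15.17) `Typed.Section15B.Eq15_17` does not mention `𝔢ⱼ` and needs
no twin. The generic-value EDGE twins (`Ded1524.eq15_23RE_of_eq15_22E_rate1`,
`Skeleton.lemma151ChiRE_of_partsR`, …) are theorems and land in a sibling file. No instances, no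
notation; nothing banked is restated.

## References
* Y. Zhang, arXiv:2211.02515v1 (2022), §15 Lemma 15.1 p. 86, (15.22) p. 87, (15.23) p. 88;
  Appendix B (B.3) p. 108. [cite: Zhang2022LandauSiegel, §15 pp. 86–88]
-/

noncomputable section

open Complex Real ComplexConjugate

/-! ## Lemma 15.1, χ-twisted readings, parametrised over `e″` -/

namespace Literature.NumberTheory.LFunctions.Zhang2022.Skeleton

/-- **Lemma 15.1, χ-twisted reading, 𝔢ⱼ := `frakeE e1pp j`** (RT-05 E-twin of
`Skeleton.Lemma151Chi c′`, `SkeletonChiTwist`; §15 p. 86): "Suppose `n₁ ∈ 𝔫(𝔮)` and `n₁ < T`. Then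
`Σ_{(n,𝔮)=1} b(n₁n)χ(n)ϱ*ⱼ(n)/n = χ(n₁)τ₂(n₁)𝔢ⱼ + O(α₁τ₂(n₁))`" (`b = χ·bcoef`, `α₁` read `α𝓛`), with
the value of `e″₁ⱼ` inside `𝔢ⱼ` a PARAMETER: instance `e1ppj` = the printed node (`Lemma151ChiE_e1ppj`,
`rfl`); instance `AppendixB.e1ppD` = the DERIVED constant `e″ = −jπi·b*` (App. B's own computation),
NOT the value stated in Lemma 15.1/(B.3) — the discharge target of record (RT-05; G-L4t10-1,
G-num2-1, D-G-num2-1). CLAIM. [cite: Zhang2022LandauSiegel, §15 Lemma 15.1 p. 86] -/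
def Lemma151ChiE (e1pp : ℕ → ℂ) (c' : ℝ) : Prop :=
  ∃ C : ℝ, ForAllLarge fun D _ χ => AssumptionA D χ → ∀ j ∈ ({1, 2, 3} : Finset ℕ), ∀ n₁ : ℕ,
    n₁ ∈ nset (frakq D) → (n₁ : ℝ) < bigT D →
      ‖(∑ n ∈ (Finset.Ico 1 ⌈bigP D⌉₊).filter (fun n => Nat.Coprime n (frakq D)),
          χ ((n₁ * n : ℕ) : ZMod D) * bcoef D (n₁ * n) * χ (n : ZMod D) *
            varrhoStar c' χ j n / (n : ℂ)) -
        χ (n₁ : ZMod D) * (n₁.divisors.card : ℂ) * frakeE e1pp j‖ ≤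
      C * alpha D * ell D * n₁.divisors.card

/-- **Lemma 15.1, χ-twisted reading with `α₁ := α log T`, 𝔢ⱼ := `frakeE e1pp j`** (RT-05 E-twin of
`Skeleton.Lemma151ChiR c′`, `SkeletonAlpha1`; the rate reading of record G-L4t10-2): as `Lemma151ChiE`
with the error `C·alpha1 D·τ₂(n₁)`. Instances: `e1ppj` = `Lemma151ChiR` (`rfl`); `e1ppD` = the DERIVED
constant `e″ = −jπi·b*`, NOT the stated one (RT-05). CLAIM. [cite: Zhang2022LandauSiegel, §15 Lemma 15.1 p. 86] -/
def Lemma151ChiRE (e1pp : ℕ → ℂ) (c' : ℝ) : Prop :=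
  ∃ C : ℝ, ForAllLarge fun D _ χ => AssumptionA D χ → ∀ j ∈ ({1, 2, 3} : Finset ℕ), ∀ n₁ : ℕ,
    n₁ ∈ nset (frakq D) → (n₁ : ℝ) < bigT D →
      ‖(∑ n ∈ (Finset.Ico 1 ⌈bigP D⌉₊).filter (fun n => Nat.Coprime n (frakq D)),
          χ ((n₁ * n : ℕ) : ZMod D) * bcoef D (n₁ * n) * χ (n : ZMod D) *
            varrhoStar c' χ j n / (n : ℂ)) -
        χ (n₁ : ZMod D) * (n₁.divisors.card : ℂ) * frakeE e1pp j‖ ≤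
      C * alpha1 D * n₁.divisors.card

/-- `Lemma151ChiE e1ppj = Lemma151Chi` (`rfl`: the printed χ-node is the `e1ppj`-instance; RT-05 C1/C2).
[cite: Zhang2022LandauSiegel, §15 Lemma 15.1 p. 86] -/
theorem Lemma151ChiE_e1ppj : Lemma151ChiE e1ppj = Lemma151Chi := rfl

/-- `Lemma151Chi c′ = Lemma151ChiE e1ppj c′` (`rfl`). [cite: Zhang2022LandauSiegel, §15 Lemma 15.1 p. 86] -/
theorem lemma151Chi_eq_E (c' : ℝ) : Lemma151Chi c' = Lemma151ChiE e1ppj c' := rfl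

/-- `Lemma151ChiRE e1ppj = Lemma151ChiR` (`rfl`; RT-05 C1/C2). [cite: Zhang2022LandauSiegel, §15 Lemma 15.1 p. 86] -/
theorem Lemma151ChiRE_e1ppj : Lemma151ChiRE e1ppj = Lemma151ChiR := rfl

/-- `Lemma151ChiR c′ = Lemma151ChiRE e1ppj c′` (`rfl`). [cite: Zhang2022LandauSiegel, §15 Lemma 15.1 p. 86] -/
theorem lemma151ChiR_eq_E (c' : ℝ) : Lemma151ChiR c' = Lemma151ChiRE e1ppj c' := rfl

end Literature.NumberTheory.LFunctions.Zhang2022.Skeleton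

/-! ## (15.22) and the repaired (15.23), parametrised over `e″` -/

namespace Literature.NumberTheory.LFunctions.Zhang2022.Typed.Section15C

open Literature.NumberTheory.LFunctions.Zhang2022.Skeleton

/-- **Z22:(15.22) with 𝔢ⱼ := `frakeE e1pp j`** (RT-05 E-twin of `Eq15_22 c′ X`, TypedSection15C:246;
§15 p. 87, tex L4306: "By (15.19)–(15.21) and Lemma 15.1 we obtain `𝒮₁ⱼ = 𝔢ⱼ𝓜₁(1,1;1−βⱼ)
Σ_{n∈𝒩(𝒬),n<T} χ(n)τ₂(n)ϖ₁ⱼ(n)/n + O(1/𝓛)`", `1 ≤ j ≤ 3`), the value of `e″₁ⱼ` inside `𝔢ⱼ` a PARAMETER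
and the §15A/B objects the structure `X` as in the owner slice. Instances: `e1ppj` = the printed node
(`Eq15_22E_e1ppj`, `rfl`); `AppendixB.e1ppD` = the DERIVED constant `e″ = −jπi·b*` (App. B's own
computation), NOT the value stated in Lemma 15.1/(B.3) — the reading the leaf h15_22 is re-typed to
(RT-05; G-L4t10-1, G-num2-1, D-G-num2-1). CLAIM. [cite: Zhang2022LandauSiegel, §15 (15.22) p. 87] -/
def Eq15_22E (e1pp : ℕ → ℂ) (c' : ℝ) (X : Inputs15AB) : Prop :=
  ∃ C : ℝ, ForAllLarge fun D _ χ => AssumptionA D χ → ∀ j ∈ ({1, 2, 3} : Finset ℕ),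
    ‖X.calS1 c' χ j - frakeE e1pp j * X.calM1 c' χ 1 1 (1 - betaJ c' D j) * sumInN c' X χ j‖ ≤
      C / ell D

/-- **Z22:(15.23) in the repaired `O(1/𝓛)` reading, with 𝔢ⱼ := `frakeE e1pp j`** (RT-05 E-twin of
`Eq15_23R c′ X`, TypedSection15C:664; §15 p. 88, tex L4372: "`𝒮₁ⱼ = 𝔢ⱼ𝔞φ(D)/D + O(1/𝓛³)`", error
`O(1/𝓛)` per G-L4t3-3 / RULING 16e). Instances: `e1ppj` = `Eq15_23R` (`rfl`); `e1ppD` = the DERIVED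
constant (RT-05). CLAIM-VARIANT. [cite: Zhang2022LandauSiegel, §15 (15.23) p. 88] -/
def Eq15_23RE (e1pp : ℕ → ℂ) (c' : ℝ) (X : Inputs15AB) : Prop :=
  ∃ C : ℝ, ForAllLarge fun D _ χ => AssumptionA D χ → ∀ j ∈ ({1, 2, 3} : Finset ℕ),
    ‖X.calS1 c' χ j - frakeE e1pp j * (frakA χ : ℂ) * (Nat.totient D : ℂ) / (D : ℂ)‖ ≤ C / ell D

/-- `Eq15_22E e1ppj = Eq15_22` (`rfl`; RT-05 C1/C2: the printed node is the `e1ppj`-instance).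
[cite: Zhang2022LandauSiegel, §15 (15.22) p. 87] -/
theorem Eq15_22E_e1ppj : Eq15_22E e1ppj = Eq15_22 := rfl

/-- `Eq15_22 c′ X = Eq15_22E e1ppj c′ X` (`rfl`). [cite: Zhang2022LandauSiegel, §15 (15.22) p. 87] -/
theorem eq15_22_eq_E (c' : ℝ) (X : Inputs15AB) : Eq15_22 c' X = Eq15_22E e1ppj c' X := rfl

/-- `Eq15_23RE e1ppj = Eq15_23R` (`rfl`; RT-05 C1/C2). [cite: Zhang2022LandauSiegel, §15 (15.23) p. 88] -/
theorem Eq15_23RE_e1ppj : Eq15_23RE e1ppj = Eq15_23R := rfl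

/-- `Eq15_23R c′ X = Eq15_23RE e1ppj c′ X` (`rfl`). [cite: Zhang2022LandauSiegel, §15 (15.23) p. 88] -/
theorem eq15_23R_eq_E (c' : ℝ) (X : Inputs15AB) : Eq15_23R c' X = Eq15_23RE e1ppj c' X := rfl

/-- **The RE-TYPED leaf of record (RT-05): (15.22) at the χ-instance `inputs15ABchi` with the DERIVED
`e″₁ⱼ = −jπi·b*`** — `Eq15_22E AppendixB.e1ppD c′ inputs15ABchi` (abbreviation for the closer and the
skeleton binder `h15_22`). [cite: Zhang2022LandauSiegel, §15 (15.22) p. 87] -/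
abbrev Eq15_22DIchi (c' : ℝ) : Prop := Eq15_22E e1ppD c' inputs15ABchi

end Literature.NumberTheory.LFunctions.Zhang2022.Typed.Section15C
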